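import Summits.AtomisticToContinuum.Crystallization.Theorems.FreeSplittingCertificatesStrictSplittingRuleCoreDefsStar
import Summits.AtomisticToContinuum.Crystallization.Theorems.FreeSplittingCertificatesStrictSplittingRuleCoreFirstOrderDesignGeometry

/-!
# Far-pair lower bound for the half-split Lennard-Jones second variation

Helper of reshape r5 (lead c5) of crux `StrictSplittingRule` (stmt-AtomisticToContinuum-12560), line `registered`:
toward the glue `H2N ∧ H2F ⇒ CoreStarCoercive` (near-field LMI + far-field Korn export ⇒ H2⋆). Registered stub, landed
`--supports stmt-AtomisticToContinuum-12560`.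
-/

noncomputable section

namespace Summit.AtomisticToContinuum.Crystallization.Theorems.StrictSplittingRuleBirth

open scoped BigOperators Classical
open Literature.MathematicalPhysics.StatisticalMechanics
open Literature.Geometry.DiscreteGeometry
open Summit.AtomisticToContinuum.Crystallization.Theorems.PalmUnimodularRigidity.LayeredLawsSelectHcp
  (hcpSite ljSqDeriv)

/-- Euclidean `3`-space. -/
local notation "E3" => EuclideanSpace ℝ (Fin 3)

/-- **stub_farPairLowerBound** (r5 helper, far field): beyond the potential minimum (`‖d‖² ≥ 1`) the half-split second
variation of one pair, `½(W′(s)‖v‖² + 2W″(s)⟨d,v⟩²)` with `s = ‖d‖²`, `W′ = ljSqDeriv`, `W″(s) = ½(7s⁻⁸ − 4s⁻⁵)`, is bounded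
below by its longitudinal part: `≥ −(7/4)·s⁻⁵·⟨d,v⟩²` (use `W′(s) ≥ 0` and `‖v‖² ≥ ⟨d,v⟩²/s`). [folklore] -/
theorem stub_farPairLowerBound : ∀ d v : E3, 1 ≤ ‖d‖ ^ 2 →
    -(7 / 4) * ((‖d‖ ^ 2)⁻¹) ^ 5 * (inner ℝ d v) ^ 2 ≤
      1 / 2 * (ljSqDeriv (‖d‖ ^ 2) * ‖v‖ ^ 2 +
        2 * (1 / 2 * (7 * ((‖d‖ ^ 2)⁻¹) ^ 8 - 4 * ((‖d‖ ^ 2)⁻¹) ^ 5)) * (inner ℝ d v) ^ 2) := by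
  intro d v hd
  -- Cauchy–Schwarz: `⟨d,v⟩² ≤ ‖d‖²‖v‖²`.
  have hcs : (inner ℝ d v) ^ 2 ≤ ‖d‖ ^ 2 * ‖v‖ ^ 2 := by
    rw [← mul_pow, ← sq_abs (inner ℝ d v)]
    exact pow_le_pow_left₀ (abs_nonneg _) (abs_real_inner_le_norm d v) 2
  simp only [ljSqDeriv]
  set s : ℝ := ‖d‖ ^ 2
  set t : ℝ := (inner ℝ d v) ^ 2
  set w : ℝ := ‖v‖ ^ 2
  have hs0 : 0 < s := one_pos.trans_le hd
  set x : ℝ := s⁻¹ with hx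
  have hx0 : 0 ≤ x := (inv_pos.2 hs0).le
  have hx1 : x ≤ 1 := inv_le_one_of_one_le₀ hd
  have ht0 : 0 ≤ t := sq_nonneg _
  -- `x·t ≤ w` (divide Cauchy–Schwarz by `s`).
  have hxt : x * t ≤ w := by
    calc x * t ≤ x * (s * w) := mul_le_mul_of_nonneg_left hcs hx0
      _ = w := by rw [← mul_assoc, hx, inv_mul_cancel₀ hs0.ne', one_mul]
  -- `W′(s) = ½(x⁴ − x⁷) ≥ 0` on `x ∈ [0,1]`, so the `‖v‖²`-term dominates `(x⁵ − x⁸)·t/4`.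
  have hx47 : x ^ 7 ≤ x ^ 4 := pow_le_pow_of_le_one hx0 hx1 (by norm_num)
  have key : (x ^ 4 - x ^ 7) * (x * t) ≤ (x ^ 4 - x ^ 7) * w :=
    mul_le_mul_of_nonneg_left hxt (sub_nonneg.2 hx47)
  nlinarith [key, mul_nonneg (pow_nonneg hx0 8) ht0, mul_nonneg (pow_nonneg hx0 5) ht0]

end Summit.AtomisticToContinuum.Crystallization.Theorems.StrictSplittingRuleBirth

end
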